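import Literature.NumberTheory.DiophantineGeometry.BelyiDegreeFaltingsHeight
import Literature.NumberTheory.DiophantineGeometry.FunctionFieldGenusWeierstrassProofs
import HarnessLib

/-!
# Javanpeykar 2014: the Riemann–Hurwitz count for Belyi functions (Lemma 3.2.2) and the status of Thm. 1.1.1

Topic `NumberTheory/DiophantineGeometry`. Proof file attached to
`Literature.NumberTheory.DiophantineGeometry.BelyiDegreeFaltingsHeight` (the named fact
`javanpeykar2014_stableFaltingsHeight_le`, Javanpeykar 2014 Thm. 1.1.1, row 1, genus `1`).

## What is proved here

The function-field step of the printed proof of Thm. 1.1.1: for a Belyi function `f` on an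
algebraic function field `F/K` with all places rational (`char K = 0`, `K` the full constant field),
written `d = [F : K(f)]`, `g` the genus, and `n₀, n₁, n_∞` the numbers of places over `0`, `1`, `∞`
(the "cusps" of the Belyi cover, [cite: Javanpeykar2014, Def. 3.2.1]):

* `IsBelyiFunction.diffOrd_eq_zero` — away from the three special fibres `(df)_P = 0`;
* `IsBelyiFunction.card_add_card_add_card_eq` — **`n₀ + n₁ + n_∞ = d + 2 - 2g`**, the
  Riemann–Hurwitz formula `2g - 2 = -2d + Σ_P (e_P - 1)` ([cite: Stichtenoth2009, Cor. 3.5.5], in the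
  tree `AlgFunctionField.finsum_diffOrd_eq`) evaluated on a map unramified outside `{0, 1, ∞}`:
  `Σ_{P|0}(e_P - 1) = d - n₀`, `Σ_{P|1}(e_P - 1) = d - n₁`, `Σ_{P|∞}(-e_P - 1) = -d - n_∞`, all other
  places contribute `0`;
* `IsBelyiFunction.two_mul_genus_add_one_le_finrank` — **`2g + 1 ≤ d`** (each special fibre is
  non-empty), whence `IsBelyiFunction.genus_le_finrank` — **Javanpeykar 2014, Lemma 3.2.2** as printed:
  "Let `π : Y → X(2)` be a Belyi cover with `Y` of genus `g`. Then `g ≤ deg π`." ("This is trivial for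
  `g ≤ 1`. For `g ≥ 2`, the statement follows from the Riemann–Hurwitz formula."), the inequality by
  which the constants of §3.4 and Thm. 4.5.2 are made to depend on `deg π` alone;
* over an algebraically closed constant field of characteristic `0` (every place rational):
  `…_of_isAlgClosed` forms, and for the function field `Ω(E)` of an elliptic curve (`g = 1`,
  `AlgFunctionField.genus_functionField_weierstrass_holds`): `three_le_finrank_of_isBelyiFunction`
  (**a Belyi function on an elliptic curve has degree `≥ 3`**), `three_le_belyiDegree`
  (`deg_B(E) ≥ 3`), and `three_le_finrank_of_isBelyiFunction_baseChange`, the same in the exact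
  setting of `javanpeykar2014_stableFaltingsHeight_le` (`E/K` over a number field, `Ω = K̄`), so that
  the right-hand side of that bound is always `≥ 13·10⁶·3⁵` and the step
  `3 log(2d²) d² ≤ 2 d⁵` of the proof of [cite: Javanpeykar2014, Thm. 4.5.2] (false for `d = 1`) is
  available.

Everything is proved; no named fact is introduced.

## What is NOT here: the discharge of `javanpeykar2014_stableFaltingsHeight_le`

The bound `h_F(E) ≤ 13·10⁶ [Ω(E) : Ω(f)]⁵` itself (proof of Thm. 1.1.1, §4.6 of the paper: Thm. 2.4.1
`h_Fal(X) ≤ ½ g(g+1) h(b) + log ‖Wr‖_Ar(b)`, Thm. 4.5.2 (a non-Weierstrass point `b` with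
`h(b) ≤ 6378033 deg_B(X)⁵ / g`), Prop. 3.5 (`log ‖Wr‖_Ar(b) ≤ 6378028 g deg_B(X)⁵`)) is Arakelov
intersection theory on semistable regular models over `O_K`, Arakelov–Green functions with Merkl's
bounds on Belyi covers of `X(2)` (appendix by Bruin), models of covers of curves (Thm. 4.3.2) and
Lenstra's bound for the different (Prop. 4.1.1). None of these theories exists in Mathlib or in the
tree at present, so the fact stays a named fact (D-0014); this file only supplies the elementary
function-field input.

## References

* A. Javanpeykar, *Polynomial bounds for Arakelov invariants of Belyi curves* (appendix by P. Bruin),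
  Algebra & Number Theory 8 (2014) 89–140, arXiv:1403.6404: Def. 3.2.1, Lemma 3.2.2, Thm. 4.5.2,
  §4.6 (proof of Thm. 1.1.1). [Javanpeykar2014]
* H. Stichtenoth, *Algebraic Function Fields and Codes*, 2nd ed., GTM 254 (2009): Thm. 1.4.11,
  Thm. 3.5.1, Cor. 3.5.5. [Stichtenoth2009]
-/

noncomputable section

open scoped IntermediateField

namespace Literature.NumberTheory.DiophantineGeometry.AlgFunctionField

universe u v

variable {K : Type u} {F : Type v} [Field K] [Field F] [Algebra K F]

namespace IsBelyiFunction

/-! ### Riemann–Hurwitz for a Belyi function: all places rational, characteristic `0` -/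

section rational

variable [IsAlgFunctionField K F] [IsIntegrallyClosedIn K F] [CharZero K]

omit [IsAlgFunctionField K F] [IsIntegrallyClosedIn K F] [CharZero K] in
/-- A Belyi function is non-zero. [folklore] -/
theorem ne_zero {f : F} (hf : IsBelyiFunction K f) : f ≠ 0 :=
  fun e ↦ hf.not_mem_range ⟨0, by rw [e, map_zero]⟩

omit [IsAlgFunctionField K F] [IsIntegrallyClosedIn K F] [CharZero K] in
/-- A Belyi function is not `1`: `f - 1 ≠ 0`. [folklore] -/
theorem sub_one_ne_zero {f : F} (hf : IsBelyiFunction K f) : f - 1 ≠ 0 :=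
  fun e ↦ hf.not_mem_range ⟨1, by rw [map_one]; exact (sub_eq_zero.1 e).symm⟩

omit [IsIntegrallyClosedIn K F] [CharZero K] in
/-- **Away from the fibres over `0`, `1`, `∞` the differential `df` has order `0`.** At a rational
place `P` where the Belyi function `f` is finite with value `f(P) = c ∉ {0, 1}`, `f` is unramified
(`v_P(f - c) = 1`), so `diffOrd_P(f) = v_P(f - c) - 1 = 0`. The three excluded cases are phrased as
`¬ 0 < v_P(f)`, `¬ 0 < v_P(f - 1)`, `¬ v_P(f) < 0`. [cite: Stichtenoth2009, Thm. 3.5.1] -/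
theorem diffOrd_eq_zero (hrat : ∀ P : PlaceOver K F, P.IsRational) {f : F}
    (hf : IsBelyiFunction K f) {P : PlaceOver K F} (h0 : ¬ 0 < P.ord f)
    (h1 : ¬ 0 < P.ord (f - 1)) (hi : ¬ P.ord f < 0) : P.diffOrd f = 0 := by
  have hy := hf.not_mem_range
  have hfP : f ∈ P.toValuationSubring := P.mem_toValuationSubring_of_ord_nonneg (not_lt.1 hi)
  have hball : f - algebraMap K F (P.value f) ∈ P.ball 1 := (hrat P).sub_value_mem hfP
  have hfc : f - algebraMap K F (P.value f) ≠ 0 := fun e ↦ hy ⟨_, (sub_eq_zero.1 e).symm⟩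
  have hord : 1 ≤ P.ord (f - algebraMap K F (P.value f)) := (P.mem_ball_iff_le_ord 1 hfc).1 hball
  have hc0 : P.value f ≠ 0 := by
    intro h
    rw [h, map_zero, sub_zero] at hord
    exact h0 (by omega)
  have hc1 : P.value f ≠ 1 := by
    intro h
    rw [h, map_one] at hord
    exact h1 (by omega)
  rw [P.diffOrd_of_sub_algebraMap_mem hball, hf.ord_sub_eq_one hc0 hc1 P (by omega), sub_self]

/-- **Riemann–Hurwitz for a Belyi function** (all places rational, `char K = 0`, `K` the full
constant field). If `U₀`, `U₁`, `U_∞` are the sets of places over `0`, `1` and `∞` — `v_P(f) > 0`,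
`v_P(f - 1) > 0`, `v_P(f) < 0` — of a Belyi function `f` of degree `d = [F : K(f)]`, then
`#U₀ + #U₁ + #U_∞ = d + 2 - 2g`: in `2g - 2 = Σ_P diffOrd_P(f)` ([cite: Stichtenoth2009, Cor. 3.5.5],
`finsum_diffOrd_eq`) the places over `0` contribute `Σ (e_P - 1) = d - #U₀`
(`sum_ord_sub_eq_finrank`, Stichtenoth Thm. 1.4.11), those over `1` contribute `d - #U₁`, the poles
`Σ (-e_P - 1) = -d - #U_∞` (`sum_neg_ord_eq_finrank`), and every other place `0`
(`diffOrd_eq_zero`). This is the computation behind [cite: Javanpeykar2014, Lemma 3.2.2]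
(the number of cusps of a Belyi cover of degree `d` and genus `g` is `d + 2 - 2g`). -/
theorem card_add_card_add_card_eq (hrat : ∀ P : PlaceOver K F, P.IsRational) {f : F}
    (hf : IsBelyiFunction K f) (U₀ U₁ Ui : Finset (PlaceOver K F))
    (hU₀ : ∀ P, P ∈ U₀ ↔ 0 < P.ord f) (hU₁ : ∀ P, P ∈ U₁ ↔ 0 < P.ord (f - 1))
    (hUi : ∀ P, P ∈ Ui ↔ P.ord f < 0) :
    (U₀.card : ℤ) + U₁.card + Ui.card = Module.finrank K⟮f⟯ F + 2 - 2 * genus K F := by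
  classical
  have hy := hf.not_mem_range
  have hf0 : f ≠ 0 := hf.ne_zero
  have hf1 : f - 1 ≠ 0 := hf.sub_one_ne_zero
  -- the places over `0` resp. `1`, in the `ball` language
  have ball0 : ∀ P ∈ U₀, f - algebraMap K F 0 ∈ P.ball 1 := fun P hP ↦ by
    rw [map_zero, sub_zero]
    exact (P.mem_ball_iff_le_ord 1 hf0).2 ((hU₀ P).1 hP)
  have ball1 : ∀ P ∈ U₁, f - algebraMap K F 1 ∈ P.ball 1 := fun P hP ↦ by
    rw [map_one]
    exact (P.mem_ball_iff_le_ord 1 hf1).2 ((hU₁ P).1 hP)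
  -- the three fibres are pairwise disjoint
  have h01 : Disjoint U₀ U₁ := Finset.disjoint_left.2 fun P hP0 hP1 ↦
    zero_ne_one (P.eq_of_sub_algebraMap_mem (ball0 P hP0) (ball1 P hP1))
  have hfin1 : ∀ P ∈ U₁, 0 ≤ P.ord f := fun P hP ↦ by
    have hmem : f - 1 ∈ P.toValuationSubring :=
      (P.mem_toValuationSubring_iff_ord_nonneg hf1).2 ((hU₁ P).1 hP).le
    have hfP : f ∈ P.toValuationSubring := by simpa using add_mem hmem (one_mem _)
    exact (P.mem_toValuationSubring_iff_ord_nonneg hf0).1 hfP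
  have h01i : Disjoint (U₀ ∪ U₁) Ui := Finset.disjoint_left.2 fun P hP hPi ↦ by
    have hi := (hUi P).1 hPi
    rcases Finset.mem_union.1 hP with h | h
    · have := (hU₀ P).1 h; omega
    · have := hfin1 P h; omega
  -- outside the three fibres `diffOrd` vanishes
  have hsupp : Function.support (fun P : PlaceOver K F ↦ P.diffOrd f) ⊆ ↑((U₀ ∪ U₁) ∪ Ui) := by
    intro P hP
    rw [Function.mem_support] at hP
    rw [Finset.coe_union, Finset.coe_union, Set.mem_union, Set.mem_union, Finset.mem_coe,
      Finset.mem_coe, Finset.mem_coe, hU₀, hU₁, hUi]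
    by_contra h
    simp only [not_or] at h
    exact hP (hf.diffOrd_eq_zero hrat h.1.1 h.1.2 h.2)
  -- the three exact sums
  have e0 : ∑ P ∈ U₀, P.diffOrd f = (Module.finrank K⟮f⟯ F : ℤ) - U₀.card := by
    rw [← sum_ord_sub_eq_finrank hrat hy 0 U₀
        (fun P hP ↦ by rw [map_zero, sub_zero]; exact (hU₀ P).1 hP)
        (fun P hP ↦ (hU₀ P).2 (by rwa [map_zero, sub_zero] at hP)),
      Finset.card_eq_sum_ones, Nat.cast_sum, Nat.cast_one, ← Finset.sum_sub_distrib]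
    exact Finset.sum_congr rfl fun P hP ↦ P.diffOrd_of_sub_algebraMap_mem (ball0 P hP)
  have e1 : ∑ P ∈ U₁, P.diffOrd f = (Module.finrank K⟮f⟯ F : ℤ) - U₁.card := by
    rw [← sum_ord_sub_eq_finrank hrat hy 1 U₁
        (fun P hP ↦ by rw [map_one]; exact (hU₁ P).1 hP)
        (fun P hP ↦ (hU₁ P).2 (by rwa [map_one] at hP)),
      Finset.card_eq_sum_ones, Nat.cast_sum, Nat.cast_one, ← Finset.sum_sub_distrib]
    exact Finset.sum_congr rfl fun P hP ↦ P.diffOrd_of_sub_algebraMap_mem (ball1 P hP)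
  have ei : ∑ P ∈ Ui, P.diffOrd f = -(Module.finrank K⟮f⟯ F : ℤ) - Ui.card := by
    rw [← sum_neg_ord_eq_finrank hrat hy Ui (fun P hP ↦ (hUi P).1 hP) (fun P hP ↦ (hUi P).2 hP),
      Finset.card_eq_sum_ones, Nat.cast_sum, Nat.cast_one, ← Finset.sum_neg_distrib,
      ← Finset.sum_sub_distrib]
    exact Finset.sum_congr rfl fun P hP ↦ by rw [P.diffOrd_of_ord_neg ((hUi P).1 hP)]; ring
  -- Riemann–Hurwitz
  have key := finsum_diffOrd_eq hrat hy
  rw [finsum_eq_sum_of_support_subset _ hsupp, Finset.sum_union h01i, Finset.sum_union h01, e0, e1,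
    ei] at key
  linarith

/-- **`2g + 1 ≤ [F : K(f)]` for a Belyi function `f`** (all places rational, `char K = 0`): each of
the fibres over `0`, `1`, `∞` is non-empty — their orders add up to `[F : K(f)] ≥ 1`
(Stichtenoth Thm. 1.4.11) — so `3 ≤ #U₀ + #U₁ + #U_∞ = [F : K(f)] + 2 - 2g`
(`card_add_card_add_card_eq`). In particular `deg_B(X) ≥ 2g + 1`, and `g ≤ deg π`
([cite: Javanpeykar2014, Lemma 3.2.2], `genus_le_finrank`). [cite: Stichtenoth2009, Cor. 3.5.5] -/
theorem two_mul_genus_add_one_le_finrank (hrat : ∀ P : PlaceOver K F, P.IsRational) {f : F}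
    (hf : IsBelyiFunction K f) : 2 * genus K F + 1 ≤ Module.finrank K⟮f⟯ F := by
  classical
  have hy := hf.not_mem_range
  have hf0 : f ≠ 0 := hf.ne_zero
  have hf1 : f - 1 ≠ 0 := hf.sub_one_ne_zero
  have hd : 0 < Module.finrank K⟮f⟯ F := hf.finrank_pos
  -- the three fibres as finite sets
  set U₀ : Finset (PlaceOver K F) :=
    (finite_setOf_ord_ne_zero_of_ne_zero (K := K) hf0).toFinset.filter fun P ↦ 0 < P.ord f with hU₀d
  set U₁ : Finset (PlaceOver K F) :=
    (finite_setOf_ord_ne_zero_of_ne_zero (K := K) hf1).toFinset.filter fun P ↦ 0 < P.ord (f - 1)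
    with hU₁d
  set Ui : Finset (PlaceOver K F) :=
    (finite_setOf_ord_ne_zero_of_ne_zero (K := K) hf0).toFinset.filter fun P ↦ P.ord f < 0 with hUid
  have hU₀ : ∀ P, P ∈ U₀ ↔ 0 < P.ord f := fun P ↦ by
    rw [hU₀d, Finset.mem_filter, Set.Finite.mem_toFinset, Set.mem_setOf_eq]
    exact ⟨fun h ↦ h.2, fun h ↦ ⟨by omega, h⟩⟩
  have hU₁ : ∀ P, P ∈ U₁ ↔ 0 < P.ord (f - 1) := fun P ↦ by
    rw [hU₁d, Finset.mem_filter, Set.Finite.mem_toFinset, Set.mem_setOf_eq]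
    exact ⟨fun h ↦ h.2, fun h ↦ ⟨by omega, h⟩⟩
  have hUi : ∀ P, P ∈ Ui ↔ P.ord f < 0 := fun P ↦ by
    rw [hUid, Finset.mem_filter, Set.Finite.mem_toFinset, Set.mem_setOf_eq]
    exact ⟨fun h ↦ h.2, fun h ↦ ⟨by omega, h⟩⟩
  have key := hf.card_add_card_add_card_eq hrat U₀ U₁ Ui hU₀ hU₁ hUi
  -- each fibre is non-empty: its orders add up to `[F : K(f)] ≠ 0`
  have s0 := sum_ord_sub_eq_finrank hrat hy 0 U₀
    (fun P hP ↦ by rw [map_zero, sub_zero]; exact (hU₀ P).1 hP)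
    (fun P hP ↦ (hU₀ P).2 (by rwa [map_zero, sub_zero] at hP))
  have s1 := sum_ord_sub_eq_finrank hrat hy 1 U₁
    (fun P hP ↦ by rw [map_one]; exact (hU₁ P).1 hP)
    (fun P hP ↦ (hU₁ P).2 (by rwa [map_one] at hP))
  have si := sum_neg_ord_eq_finrank hrat hy Ui (fun P hP ↦ (hUi P).1 hP) (fun P hP ↦ (hUi P).2 hP)
  have hd' : (Module.finrank K⟮f⟯ F : ℤ) ≠ 0 := by exact_mod_cast hd.ne'
  have c0 : 0 < U₀.card :=
    Finset.card_pos.2 (Finset.nonempty_of_sum_ne_zero (by rw [s0]; exact hd'))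
  have c1 : 0 < U₁.card :=
    Finset.card_pos.2 (Finset.nonempty_of_sum_ne_zero (by rw [s1]; exact hd'))
  have ci : 0 < Ui.card :=
    Finset.card_pos.2 (Finset.nonempty_of_sum_ne_zero (by rw [si]; exact hd'))
  omega

/-- **Javanpeykar 2014, Lemma 3.2.2** ("Let `π : Y → X(2)` be a Belyi cover with `Y` of genus `g`.
Then `g ≤ deg π`."), in the function-field dictionary: for a Belyi function `f` of `F/K` (all places
rational, `char K = 0`, `K` the full constant field) the genus of `F/K` is at most `[F : K(f)]`.
From the sharper `two_mul_genus_add_one_le_finrank`. [cite: Javanpeykar2014, Lemma 3.2.2] -/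
theorem genus_le_finrank (hrat : ∀ P : PlaceOver K F, P.IsRational) {f : F}
    (hf : IsBelyiFunction K f) : genus K F ≤ Module.finrank K⟮f⟯ F := by
  have := hf.two_mul_genus_add_one_le_finrank hrat
  omega

end rational

/-! ### Algebraically closed constant field of characteristic `0` (the setting `K = ℚ̄` of the paper) -/

section algClosed

variable [IsAlgFunctionField K F] [IsAlgClosed K] [CharZero K]

/-- `2g + 1 ≤ [F : K(f)]` for a Belyi function over an algebraically closed constant field of
characteristic `0` (every place is rational, `PlaceOver.isRational_of_isAlgClosed`).
[cite: Javanpeykar2014, Lemma 3.2.2] [cite: Stichtenoth2009, Cor. 3.5.5] -/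
theorem two_mul_genus_add_one_le_finrank_of_isAlgClosed {f : F} (hf : IsBelyiFunction K f) :
    2 * genus K F + 1 ≤ Module.finrank K⟮f⟯ F := by
  haveI := isIntegrallyClosedIn_of_isAlgClosed (K := K) (F := F)
  exact hf.two_mul_genus_add_one_le_finrank PlaceOver.isRational_of_isAlgClosed

/-- **Javanpeykar 2014, Lemma 3.2.2** over an algebraically closed constant field of characteristic
`0`: `g ≤ [F : K(f)]` for every Belyi function `f`. [cite: Javanpeykar2014, Lemma 3.2.2] -/
theorem genus_le_finrank_of_isAlgClosed {f : F} (hf : IsBelyiFunction K f) :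
    genus K F ≤ Module.finrank K⟮f⟯ F := by
  haveI := isIntegrallyClosedIn_of_isAlgClosed (K := K) (F := F)
  exact hf.genus_le_finrank PlaceOver.isRational_of_isAlgClosed

/-- The cusp count over an algebraically closed constant field of characteristic `0`:
`#U₀ + #U₁ + #U_∞ = [F : K(f)] + 2 - 2g`. [cite: Stichtenoth2009, Cor. 3.5.5] -/
theorem card_add_card_add_card_eq_of_isAlgClosed {f : F} (hf : IsBelyiFunction K f)
    (U₀ U₁ Ui : Finset (PlaceOver K F)) (hU₀ : ∀ P, P ∈ U₀ ↔ 0 < P.ord f)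
    (hU₁ : ∀ P, P ∈ U₁ ↔ 0 < P.ord (f - 1)) (hUi : ∀ P, P ∈ Ui ↔ P.ord f < 0) :
    (U₀.card : ℤ) + U₁.card + Ui.card = Module.finrank K⟮f⟯ F + 2 - 2 * genus K F := by
  haveI := isIntegrallyClosedIn_of_isAlgClosed (K := K) (F := F)
  exact hf.card_add_card_add_card_eq PlaceOver.isRational_of_isAlgClosed U₀ U₁ Ui hU₀ hU₁ hUi

end algClosed

end IsBelyiFunction

end Literature.NumberTheory.DiophantineGeometry.AlgFunctionField

/-! ### Elliptic function fields: a Belyi function on an elliptic curve has degree at least `3` -/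

namespace Literature.NumberTheory.DiophantineGeometry

open AlgFunctionField

universe u

section Weierstrass

variable {Ω : Type u} [Field Ω] [IsAlgClosed Ω] [CharZero Ω] (W : WeierstrassCurve.Affine Ω)
  [W.IsElliptic]

/-- **A Belyi function on an elliptic curve has degree `≥ 3`.** For the function field `Ω(E)` of an
elliptic curve over an algebraically closed field of characteristic `0` (genus `1`,
`genus_functionField_weierstrass_holds`) and a Belyi function `f ∈ Ω(E)`: `3 = 2g + 1 ≤ [Ω(E) : Ω(f)]`
(the three fibres over `0, 1, ∞` have `d` points in total and are non-empty). Equivalently: there is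
no Belyi map `E → ℙ¹` of degree `1` or `2`. [cite: Javanpeykar2014, Lemma 3.2.2] [cite: Stichtenoth2009, Cor. 3.5.5] -/
theorem three_le_finrank_of_isBelyiFunction {f : W.FunctionField} (hf : IsBelyiFunction Ω f) :
    3 ≤ Module.finrank Ω⟮f⟯ W.FunctionField := by
  have h := hf.two_mul_genus_add_one_le_finrank_of_isAlgClosed
  rwa [genus_functionField_weierstrass_holds Ω W] at h

/-- **`deg_B(E) ≥ 3`**: the Belyi degree of the function field of an elliptic curve over an
algebraically closed field of characteristic `0` is at least `3`, as soon as it carries a Belyi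
function at all (otherwise `belyiDegree` is the junk value `0`). [cite: Javanpeykar2014, Lemma 3.2.2] -/
theorem three_le_belyiDegree (hex : ∃ f : W.FunctionField, IsBelyiFunction Ω f) :
    3 ≤ belyiDegree Ω W.FunctionField := by
  obtain ⟨f, hf, hdeg⟩ := exists_finrank_eq_belyiDegree hex
  rw [← hdeg]
  exact three_le_finrank_of_isBelyiFunction W hf

end Weierstrass

/-- The same in the exact setting of `javanpeykar2014_stableFaltingsHeight_le`: for an elliptic curve
`E/K` over a number field, an algebraic closure `Ω` of `K` and a Belyi function `f` on `E_Ω`,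
`3 ≤ [Ω(E) : Ω(f)]` — so the right-hand side `13·10⁶ [Ω(E) : Ω(f)]⁵` of Javanpeykar's bound is at
least `13·10⁶·3⁵`, and the numerical step `3 log(2d²) d² ≤ 2d⁵` in the proof of
[cite: Javanpeykar2014, Thm. 4.5.2] (which needs `d ≥ 2`) applies. [cite: Javanpeykar2014, Lemma 3.2.2] -/
theorem three_le_finrank_of_isBelyiFunction_baseChange (K : Type) [Field K] [NumberField K]
    (W : WeierstrassCurve K) [W.IsElliptic] (Ω : Type) [Field Ω] [Algebra K Ω] [IsAlgClosure K Ω]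
    {f : (W.baseChange Ω).toAffine.FunctionField} (hf : IsBelyiFunction Ω f) :
    3 ≤ Module.finrank Ω⟮f⟯ (W.baseChange Ω).toAffine.FunctionField := by
  haveI : IsAlgClosed Ω := IsAlgClosure.isAlgClosed K
  haveI : CharZero Ω := charZero_of_injective_algebraMap (algebraMap K Ω).injective
  haveI : (W.baseChange Ω).IsElliptic := by rw [WeierstrassCurve.baseChange]; infer_instance
  exact three_le_finrank_of_isBelyiFunction (W.baseChange Ω).toAffine hf

/-- Consequently the bound of `javanpeykar2014_stableFaltingsHeight_le` is never better than
`h_F(E) ≤ 13·10⁶·3⁵`: for every Belyi function `f` on `E_Ω`,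
`13·10⁶·3⁵ ≤ 13·10⁶·[Ω(E) : Ω(f)]⁵`. [cite: Javanpeykar2014, Lemma 3.2.2] -/
theorem javanpeykar2014_bound_ge (K : Type) [Field K] [NumberField K]
    (W : WeierstrassCurve K) [W.IsElliptic] (Ω : Type) [Field Ω] [Algebra K Ω] [IsAlgClosure K Ω]
    {f : (W.baseChange Ω).toAffine.FunctionField} (hf : IsBelyiFunction Ω f) :
    (13 * 10 ^ 6 * 3 ^ 5 : ℝ) ≤
      13 * 10 ^ 6 * (Module.finrank Ω⟮f⟯ (W.baseChange Ω).toAffine.FunctionField : ℝ) ^ 5 := by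
  have h3 : (3 : ℝ) ≤ Module.finrank Ω⟮f⟯ (W.baseChange Ω).toAffine.FunctionField := by
    exact_mod_cast three_le_finrank_of_isBelyiFunction_baseChange K W Ω hf
  gcongr

end Literature.NumberTheory.DiophantineGeometry

end

/-! ### The number of cusps is at most `3 deg π` (appended) -/

namespace Literature.NumberTheory.DiophantineGeometry.AlgFunctionField.IsBelyiFunction

open scoped IntermediateField

universe u' v'

variable {K : Type u'} {F : Type v'} [Field K] [Field F] [Algebra K F]
variable [IsAlgFunctionField K F] [IsIntegrallyClosedIn K F] [CharZero K]

/-- **`n ≤ 3d`**: the number `n = #U₀ + #U₁ + #U_∞` of cusps of a Belyi function of degree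
`d = [F : K(f)]` (all places rational, characteristic `0`) is at most `3d` — indeed
`n = d + 2 - 2g ≤ d + 2 ≤ 3d` ("Since `n` is the number of cusps of `Y`, we have `n ≤ 3d`", the
hypothesis on `n` in the proof of [cite: Javanpeykar2014, Thm. 3.4.5]; cf.
`Javanpeykar2014.thm345_constant`). [cite: Javanpeykar2014, Thm. 3.4.5 (proof)] -/
theorem card_add_card_add_card_le (hrat : ∀ P : PlaceOver K F, P.IsRational) {f : F}
    (hf : IsBelyiFunction K f) (U₀ U₁ Ui : Finset (PlaceOver K F))
    (hU₀ : ∀ P, P ∈ U₀ ↔ 0 < P.ord f) (hU₁ : ∀ P, P ∈ U₁ ↔ 0 < P.ord (f - 1))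
    (hUi : ∀ P, P ∈ Ui ↔ P.ord f < 0) :
    U₀.card + U₁.card + Ui.card ≤ 3 * Module.finrank K⟮f⟯ F := by
  have h := hf.card_add_card_add_card_eq hrat U₀ U₁ Ui hU₀ hU₁ hUi
  have hd : 0 < Module.finrank K⟮f⟯ F := hf.finrank_pos
  have hg : (0 : ℤ) ≤ (genus K F : ℤ) := Int.natCast_nonneg _
  have h' : ((U₀.card + U₁.card + Ui.card : ℕ) : ℤ) ≤ ((3 * Module.finrank K⟮f⟯ F : ℕ) : ℤ) := by
    push_cast
    linarith
  exact_mod_cast h'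

omit [IsIntegrallyClosedIn K F] in
/-- The same over an algebraically closed constant field of characteristic `0`. [cite:
Javanpeykar2014, Thm. 3.4.5 (proof)] -/
theorem card_add_card_add_card_le_of_isAlgClosed [IsAlgClosed K] {f : F}
    (hf : IsBelyiFunction K f) (U₀ U₁ Ui : Finset (PlaceOver K F))
    (hU₀ : ∀ P, P ∈ U₀ ↔ 0 < P.ord f) (hU₁ : ∀ P, P ∈ U₁ ↔ 0 < P.ord (f - 1))
    (hUi : ∀ P, P ∈ Ui ↔ P.ord f < 0) :
    U₀.card + U₁.card + Ui.card ≤ 3 * Module.finrank K⟮f⟯ F := by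
  haveI := isIntegrallyClosedIn_of_isAlgClosed (K := K) (F := F)
  exact hf.card_add_card_add_card_le PlaceOver.isRational_of_isAlgClosed U₀ U₁ Ui hU₀ hU₁ hUi

end Literature.NumberTheory.DiophantineGeometry.AlgFunctionField.IsBelyiFunction
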